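import Literature.Barriers.PneNP.RelativizedCircuitSizeThm31
import Literature.Computability.Complexity.WilsonOracle
import Literature.Computability.Complexity.PolyAdviceClosure
import Mathlib.Analysis.SpecialFunctions.Log.Basic
import HarnessLib

/-!
# Barrier catalogue `PneNP`: relativized circuit size — Wilson's circuit for `Wilson.oracle`

Companion of `RelativizedCircuitSize.lean` (the barrier entry: Wilson's contrary oracles for the
circuit size of `P`, `NP`, `Δ₂^P`) and of `RelativizedCircuitSizeThm31.lean`, where the named fact
`Wilson1985_thm_3_1` — C. B. Wilson, *Relativized circuit complexity*, J. Comput. Syst. Sci. 31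
(1985), **Thm. 3.1** (p. 175, with Lemma 2, pp. 173–175): "`∃ B, Δ₂^{P,B} ⊆ SIZE^B(2n + o(n))`" —
is discharged (`Wilson1985_thm_3_1_holds`, oracle `WilsonB.oracleB`).

This file completes the tree's second, independently organised rendering of Wilson's Lemma 2,
`Literature/Computability/Complexity/WilsonOracle.lean` (forcing of the `NP^B` level by finite
conditions `(I, O)`, stages clocked by `T(s) = 2^{(log₂ s)²} = s^{log s}`, fresh suffixes `α_s`,
EVERY input length coded — no patching of small lengths by universal circuits), by building
Wilson's circuit and doing the `o(n)` accounting: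

* `Wilson1985.exists_enum` — an enumeration `e` of all descriptions `(M, q; V, q_V; p)` with
  polynomial-time `M`, `V` ("machines as strings", from `countable_setOf_isPolyTime`); relative to
  `B = Wilson.oracle e` every `L ∈ Δ₂^{P,B}` is described by some `e d` (`Wilson.exists_describes`)
  and then, for every input `x`, `1^d 0 x α_{s(d,|x|)} ∈ B ↔ x ∈ L` (`Wilson.code_mem_oracle_iff`);
* `Wilson1985.codeCircuit` — Wilson's circuit of Fig. 1 (p. 173: "`i` and `α` will be hardwired
  into the circuit and `x` will be the input"): the constant gates `true`, `false` and ONE oracle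
  gate of fan-in `d + 1 + n + |α|` wired in the pattern `1^d 0 x α` (`Wilson1985.codeArgs`); it
  outputs `[1^d 0 x α ∈ B]` (`eval_codeCircuit`), is over `B₂ ∪ oracleGates B`
  (`codeCircuit_isOver`), and has fan-in-charged size `≤ d + n + |α| + 4`
  (`oracleSize_codeCircuit_le`; the tree's `oracleGateCost` charges an oracle gate its fan-in, as
  Wilson counts edges: "each `α_n` has no more than `t(n)` edges", p. 172);
* `Wilson1985.codeFamily` / `codeFamily_decides` — at length `n` the code circuit with the suffix
  of the stage `s(d, n)` at which the block `(d, n)` is scheduled decides `L`;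
* `Wilson1985.isSublinear_slack` — since `s(d, n) = n` for all large `n`
  (`Wilson.exists_sched_eq_self`) and `|α_n| = n + (log₂ n)² + 3 log₂(n+1) + 5` (`Wilson.sufLen`),
  the size is `2n + r(n)` with `r(n) ≤ (log₂ n)² + 3 log₂(n+1) + d + 9` eventually
  (`slack_le_eventually`), an `o(n)` via `Real.isLittleO_pow_log_id_atTop` — Wilson, p. 175: "The
  size of the circuit `⟨i, x⟩α` is `n + |α| = log T(c_i n^{k_i}) + c_i n^{k_i} + n + 3`", with
  `T(n) = n^{log n}` and `c = k = 1`;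
* `Wilson1985.oracle_deltaTwo_subset` — **`Δ₂^{P,B} ⊆ SIZE^B(2n + o(n))` for `B = Wilson.oracle e`**
  (so `⟨Wilson.oracle e, Wilson1985.oracle_deltaTwo_subset e he⟩ : Wilson1985_thm_3_1`; the named
  fact itself is not re-derived here, its discharge being `Wilson1985_thm_3_1_holds`).

Finally the hypothesis-free readings of Thm. 3.1 promised in `RelativizedCircuitSize.lean`
(`exists_deltaTwo_subset_linear`: `∃ B, Δ₂^{P,B} ⊆ ⋃_c SIZE^B(c·n + c)`;
`not_relativizes_superlinear_deltaTwo`: superlinear circuit lower bounds for `Δ₂^P` do not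
relativize), from `Wilson1985_thm_3_1_holds`; the barrier as a whole is
`RelativizedCircuitSize_holds` (`RelativizedCircuitSizeHolds.lean`).

## References

* C. B. Wilson, *Relativized circuit complexity*, J. Comput. Syst. Sci. 31 (1985) 169–181, §2
  (p. 172), Lemma 2 (pp. 173–175) with Fig. 1 (p. 173), Thm. 3.1 (p. 175), §1.2 (a) (p. 170)
  [Wilson1985] (held; `lit read paper:doi-10-1016-0022-0000-85-90040-6`, PDF page = journal
  page − 168).
-/

namespace Literature.Barriers.PneNP

open _root_.Computability Literature.Computability.Complexity Filter Asymptotics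

namespace Wilson1985

open Literature.Computability.Complexity.Wilson

/-! ### Enumerating the polynomial-time descriptions -/

/-- **Machines as strings**: some sequence `e : ℕ → Descr` contains every description whose two
oracle algorithms are polynomial-time (from the tree's `countable_setOf_isPolyTime` via
`BGS.exists_enum_pair`). [cite: Wilson1985, Lemma 2 (proof, p. 173: "Let `M_i` be an enumeration of the deterministic query machines ... and let `NM_i` be an enumeration of nondeterministic machines")] -/
theorem exists_enum :
    ∃ e : ℕ → Descr, {D : Descr | D.M.IsPolyTime encodingBoolBool ∧ D.V.IsPolyTime encodingBoolBool} ⊆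
      Set.range e := by
  obtain ⟨e₁, he₁⟩ := BGS.exists_enum_pair
  haveI : Countable (Polynomial ℕ) := Literature.Computability.QuantumComplexity.countable_polynomial_nat
  have hc : Set.Countable (Set.range fun t : ℕ × ℕ × Polynomial ℕ =>
      (⟨(e₁ t.1).1, (e₁ t.1).2, (e₁ t.2.1).1, (e₁ t.2.1).2, t.2.2⟩ : Descr)) :=
    Set.countable_range _
  refine Set.countable_iff_exists_subset_range.1 (hc.mono ?_)
  rintro ⟨M, q, V, qV, p⟩ ⟨hM, hV⟩
  obtain ⟨i, hi⟩ := he₁ (show (M, q) ∈ {D : OracleAlg Bool × Polynomial ℕ | _} from hM)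
  obtain ⟨j, hj⟩ := he₁ (show (V, qV) ∈ {D : OracleAlg Bool × Polynomial ℕ | _} from hV)
  exact ⟨(i, j, p), by simp [hi, hj]⟩

/-! ### The code circuit -/

/-- Composition distributes over `Fin.append`. [folklore] -/
theorem comp_fin_append {γ δ : Type} {m k : ℕ} (h : γ → δ) (f : Fin m → γ) (g : Fin k → γ) :
    h ∘ Fin.append f g = Fin.append (h ∘ f) (h ∘ g) := by
  funext i
  refine Fin.addCases (fun i => ?_) (fun j => ?_) i
  · simp [Fin.append_left]
  · simp [Fin.append_right]

/-- **The wiring of the code gate**: positions `< d` read the constant `true` (gate `0`),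
position `d` the constant `false` (gate `1`), the next `n` positions the inputs, the last
`|α|` positions the constant gates spelling `α` (Wilson, Fig. 1: the query `⟨i, x⟩α` with `i`,
`α` hard-wired). [cite: Wilson1985, Lemma 2 (proof, p. 173, Fig. 1)] -/
def codeArgs (d n : ℕ) (α : List Bool) : Fin (d + 1 + n + α.length) → Fin n ⊕ ℕ :=
  Fin.append
    (Fin.append (Fin.append (fun _ : Fin d => (Sum.inr 0 : Fin n ⊕ ℕ)) fun _ : Fin 1 => Sum.inr 1)
      fun i : Fin n => Sum.inl i)
    fun j : Fin α.length => if α.get j = true then Sum.inr 0 else Sum.inr 1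

/-- Reading the wires of the code gate spells the code `1^d 0 x α`. [cite: Wilson1985, Lemma 2 (proof, p. 173, Fig. 1)] -/
theorem ofFn_comp_codeArgs (d n : ℕ) (α : List Bool) (h : Fin n ⊕ ℕ → Bool)
    (h0 : h (Sum.inr 0) = true) (h1 : h (Sum.inr 1) = false) :
    List.ofFn (h ∘ codeArgs d n α) = code d (List.ofFn fun i => h (Sum.inl i)) α := by
  unfold codeArgs
  rw [comp_fin_append, comp_fin_append, comp_fin_append, List.ofFn_fin_append,
    List.ofFn_fin_append, List.ofFn_fin_append]
  have hα : List.ofFn (h ∘ fun j : Fin α.length => if α.get j = true then Sum.inr 0 else Sum.inr 1) = α := by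
    conv_rhs => rw [← List.ofFn_get α]
    congr 1
    funext j
    simp only [Function.comp_apply]
    cases α.get j <;> simp [h0, h1]
  rw [hα]
  simp only [Function.comp_def, h0, h1, List.ofFn_const, code]
  simp

/-- The code gate refers only to the two constant gates. [folklore] -/
theorem lt_two_of_codeArgs_eq_inr (d n : ℕ) (α : List Bool) (a : Fin (d + 1 + n + α.length))
    (m : ℕ) (hm : codeArgs d n α a = Sum.inr m) : m < 2 := by
  unfold codeArgs at hm
  revert hm
  refine Fin.addCases (fun i => ?_) (fun j => ?_) a
  · rw [Fin.append_left]
    refine Fin.addCases (fun i => ?_) (fun j => ?_) i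
    · rw [Fin.append_left]
      refine Fin.addCases (fun i => ?_) (fun j => ?_) i
      · rw [Fin.append_left]
        intro h
        cases h
        omega
      · rw [Fin.append_right]
        intro h
        cases h
        omega
    · rw [Fin.append_right]
      intro h
      cases h
  · rw [Fin.append_right]
    split_ifs <;> intro h <;> cases h <;> omega

/-- **Wilson's circuit** for description `d` at length `n` with stage suffix `α`: the constant
gates `true`, `false` and one `B`-oracle gate of fan-in `d + 1 + n + |α|` querying `1^d 0 x α`
(Fig. 1). [cite: Wilson1985, Lemma 2 (proof, p. 173, Fig. 1: "The single circuit accepting `Lⁿ` is described by `λx. ⟨i, x⟩α_N`")] -/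
noncomputable def codeCircuit (B : Language Bool) (d n : ℕ) (α : List Bool) : Circuit (Fin n) where
  gates := [⟨0, fun _ => true, Fin.elim0⟩, ⟨0, fun _ => false, Fin.elim0⟩,
    ⟨d + 1 + n + α.length, B.sliceFn (d + 1 + n + α.length), codeArgs d n α⟩]
  output := Sum.inr 2
  wf j hj a m hm := by
    match j, hj, a, hm with
    | 0, _, a, _ => exact a.elim0
    | 1, _, a, _ => exact a.elim0
    | 2, _, a, hm => exact lt_two_of_codeArgs_eq_inr d n α a m hm
    | k + 3, hj, _, _ => simp at hj
  wf_output m h := by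
    cases h
    simp

/-- **The circuit outputs `[1^d 0 x α ∈ B]`.** [cite: Wilson1985, Lemma 2 (proof, pp. 173–174)] -/
theorem eval_codeCircuit (B : Language Bool) (d n : ℕ) (α : List Bool) (v : Fin n → Bool) :
    (codeCircuit B d n α).eval v = B.boolIndicator (code d (List.ofFn v) α) := by
  have key : B.boolIndicator (code d (List.ofFn v) α) =
      B.sliceFn (d + 1 + n + α.length)
        (Sum.elim v (fun k => [true, false].getD k false) ∘ codeArgs d n α) := by
    unfold Language.sliceFn
    rw [ofFn_comp_codeArgs d n α _ rfl rfl]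
    rfl
  rw [key]
  simp only [Circuit.eval, codeCircuit, Circuit.wireVals, List.foldl, List.nil_append,
    List.cons_append, List.getD_cons_succ, List.getD_cons_zero]
  congr 1
  funext a
  simp only [Function.comp_apply]
  cases codeArgs d n α a with
  | inl i => rfl
  | inr m => rfl

/-- The circuit is over `B₂ ∪ oracleGates B` (two fan-in-`0` gates and one `B`-gate). [folklore] -/
theorem codeCircuit_isOver (B : Language Bool) (d n : ℕ) (α : List Bool) :
    (codeCircuit B d n α).IsOver (B2 ∪ oracleGates B) := by
  intro g hg
  simp only [codeCircuit, List.mem_cons, List.not_mem_nil, or_false] at hg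
  rcases hg with rfl | rfl | rfl
  · exact Or.inl (Nat.zero_le 2)
  · exact Or.inl (Nat.zero_le 2)
  · exact Or.inr (sliceFn_mem_oracleGates B _)

/-- **The fan-in-charged size is `≤ d + n + |α| + 4`**: two unit-cost constants and an oracle gate
charged its fan-in `d + 1 + n + |α|` (Wilson: "each `α_n` has no more than `t(n)` edges", the
edges being the input wires of the oracle gate). [cite: Wilson1985, §2 (p. 172) and Lemma 2 (proof, p. 175: "The size of the circuit `⟨i, x⟩α` is `n + |α|`")] -/
theorem oracleSize_codeCircuit_le (B : Language Bool) (d n : ℕ) (α : List Bool) :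
    oracleSize (codeCircuit B d n α) ≤ d + n + α.length + 4 := by
  simp only [oracleSize, Circuit.sizeWith, codeCircuit, List.map_cons, List.map_nil,
    List.sum_cons, List.sum_nil, Nat.add_zero, Gate.fn, oracleGateCost]
  split_ifs <;> omega

/-! ### The circuit family of a description -/

variable (e : ℕ → Descr) (d : ℕ)

/-- **Wilson's circuit family** for description `d`: at length `n`, the code circuit with the
suffix of the stage at which the block `(d, n)` is scheduled. [cite: Wilson1985, Lemma 2 (proof, p. 174: "Let `α_N` be the string chosen at stage `N`")] -/
noncomputable def codeFamily : CircuitFamily :=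
  fun n => codeCircuit (oracle e) d n (alpha e (sched e d n))

/-- **The family decides `L`** whenever `e d` describes `L` relative to the oracle (coding
theorem `Wilson.code_mem_oracle_iff`). [cite: Wilson1985, Lemma 2 (proof, p. 174)] -/
theorem codeFamily_decides {L : Language Bool} (hD : (e d).Describes (oracle e) L) :
    (codeFamily e d).Decides L := by
  intro x
  change (codeCircuit (oracle e) d x.length (alpha e (sched e d x.length))).eval x.get =
    L.boolIndicator x
  rw [eval_codeCircuit, List.ofFn_get]
  exact boolIndicator_eq_of_iff (code_mem_oracle_iff e hD x)

/-- The size slack `r(n) = size(C_n) ∸ 2n`. [cite: Wilson1985, Thm. 3.1 (the `o(n)` term)] -/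
noncomputable def slack (n : ℕ) : ℕ :=
  oracleSize (codeFamily e d n) - 2 * n

/-- `size(C_n) ≤ 2n + r(n)`. [folklore] -/
theorem oracleSize_codeFamily_le (n : ℕ) : oracleSize (codeFamily e d n) ≤ 2 * n + slack e d n :=
  le_add_tsub

/-- **Eventually `r(n) ≤ (log₂ n)² + 3 log₂(n+1) + d + 9`**: for large `n` the block `(d, n)` is
scheduled at stage `n`, so `|α| = n + (log₂ n)² + 3 log₂(n+1) + 5`. [cite: Wilson1985, Lemma 2 (proof, p. 175) and Thm. 3.1 (p. 175: `T(n) = n^{log n}`, `c = k = 1`)] -/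
theorem slack_le_eventually :
    ∃ N : ℕ, ∀ n, N ≤ n → slack e d n ≤ clockExp n + 3 * Nat.log 2 (n + 1) + (d + 9) := by
  obtain ⟨N, hN⟩ := exists_sched_eq_self e d
  refine ⟨N, fun n hn => ?_⟩
  unfold slack codeFamily
  rw [hN n hn]
  have h := oracleSize_codeCircuit_le (oracle e) d n (alpha e n)
  rw [length_alpha] at h
  unfold sufLen at h
  omega

/-! ### The `o(n)` accounting -/

/-- `(log₂(n+1))² = o(n)` over `ℝ` (from `Real.isLittleO_pow_log_id_atTop`). [folklore] -/
theorem natLog_sq_isLittleO :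
    (fun n : ℕ => ((Nat.log 2 (n + 1) : ℕ) : ℝ) ^ 2) =o[atTop] fun n : ℕ => (n : ℝ) := by
  -- `log(x)² = o(x)` along `x = n + 1`
  have h1 : (fun x : ℝ => Real.log x ^ 2) =o[atTop] id := Real.isLittleO_pow_log_id_atTop
  have hk : Tendsto (fun n : ℕ => (n : ℝ) + 1) atTop atTop :=
    tendsto_atTop_add_const_right _ 1 tendsto_natCast_atTop_atTop
  have h2 : (fun n : ℕ => Real.log ((n : ℝ) + 1) ^ 2) =o[atTop] fun n : ℕ => (n : ℝ) + 1 :=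
    h1.comp_tendsto hk
  -- `n + 1 = O(n)`
  have h3 : (fun n : ℕ => (n : ℝ) + 1) =O[atTop] fun n : ℕ => (n : ℝ) := by
    refine IsBigO.of_bound 2 (eventually_atTop.2 ⟨1, fun n hn => ?_⟩)
    have hn' : (1 : ℝ) ≤ n := by exact_mod_cast hn
    rw [Real.norm_of_nonneg (by positivity), Real.norm_of_nonneg (by positivity)]
    linarith
  -- `Nat.log 2 (n+1) ≤ log(n+1) / log 2`
  have h4 : (fun n : ℕ => ((Nat.log 2 (n + 1) : ℕ) : ℝ) ^ 2) =O[atTop]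
      fun n : ℕ => Real.log ((n : ℝ) + 1) ^ 2 := by
    refine IsBigO.of_bound ((Real.log 2)⁻¹ ^ 2) (Eventually.of_forall fun n => ?_)
    have hlog2 : 0 < Real.log 2 := Real.log_pos one_lt_two
    have hpow : ((2 : ℕ) : ℝ) ^ Nat.log 2 (n + 1) ≤ (n : ℝ) + 1 := by
      have := Nat.pow_log_le_self 2 (Nat.succ_ne_zero n)
      exact_mod_cast this
    have hle : (Nat.log 2 (n + 1) : ℝ) * Real.log 2 ≤ Real.log ((n : ℝ) + 1) := by
      rw [← Real.log_pow]
      exact Real.log_le_log (by positivity) (by simpa using hpow)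
    have hle' : ((Nat.log 2 (n + 1) : ℕ) : ℝ) ≤ (Real.log 2)⁻¹ * Real.log ((n : ℝ) + 1) := by
      rw [← div_eq_inv_mul, le_div_iff₀ hlog2]
      exact hle
    have hnn : (0 : ℝ) ≤ ((Nat.log 2 (n + 1) : ℕ) : ℝ) := Nat.cast_nonneg _
    rw [Real.norm_of_nonneg (by positivity), Real.norm_of_nonneg (by positivity), ← mul_pow]
    exact pow_le_pow_left₀ hnn hle' 2
  exact h4.trans_isLittleO (h2.trans_isBigO h3)

/-- **The slack is sublinear**: `r = o(n)`. [cite: Wilson1985, Thm. 3.1 (`2n + o(n)`)] -/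
theorem isSublinear_slack : IsSublinear (slack e d) := by
  obtain ⟨N, hN⟩ := slack_le_eventually e d
  -- the real majorant `g n = 4 (log₂(n+1))² + (d + 9)`
  have hconst : (fun _ : ℕ => (d : ℝ) + 9) =o[atTop] fun n : ℕ => (n : ℝ) :=
    isLittleO_const_left.2 (Or.inr
      (tendsto_natCast_atTop_atTop.congr fun n => (Real.norm_natCast n).symm))
  have hg : (fun n : ℕ => 4 * ((Nat.log 2 (n + 1) : ℕ) : ℝ) ^ 2 + ((d : ℝ) + 9)) =o[atTop]
      fun n : ℕ => (n : ℝ) :=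
    (natLog_sq_isLittleO.const_mul_left 4).add hconst
  refine IsBigO.trans_isLittleO ?_ hg
  refine IsBigO.of_bound 1 (eventually_atTop.2 ⟨N, fun n hn => ?_⟩)
  have hℓ : Nat.log 2 n ≤ Nat.log 2 (n + 1) := Nat.log_mono_right (Nat.le_succ n)
  have hℓ2 : Nat.log 2 (n + 1) ≤ Nat.log 2 (n + 1) ^ 2 := by
    rcases Nat.eq_zero_or_pos (Nat.log 2 (n + 1)) with h | h
    · rw [h]; exact le_rfl
    · exact Nat.le_self_pow two_ne_zero _
  have hnat : slack e d n ≤ 4 * Nat.log 2 (n + 1) ^ 2 + (d + 9) := by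
    have h1 := hN n hn
    have h2 : clockExp n ≤ Nat.log 2 (n + 1) ^ 2 := Nat.pow_le_pow_left hℓ 2
    unfold clockExp at h1 h2
    nlinarith
  have hreal : (slack e d n : ℝ) ≤ 4 * ((Nat.log 2 (n + 1) : ℕ) : ℝ) ^ 2 + ((d : ℝ) + 9) := by
    exact_mod_cast hnat
  rw [one_mul, Real.norm_of_nonneg (Nat.cast_nonneg _), Real.norm_of_nonneg (by positivity)]
  exact hreal

/-- **`Δ₂^{P,B} ⊆ SIZE^B(2n + o(n))` for `B = Wilson.oracle e`**, provided `e` contains every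
description with polynomial-time algorithms: a language `L ∈ P^K`, `K ∈ NP^B`, is described by
some `e d` (`Wilson.exists_describes`) and decided by the code circuits of `d` at every length.
[cite: Wilson1985, Lemma 2 (pp. 173–175) and Thm. 3.1 (p. 175)] -/
theorem oracle_deltaTwo_subset
    (he : {D : Descr | D.M.IsPolyTime encodingBoolBool ∧ D.V.IsPolyTime encodingBoolBool} ⊆
      Set.range e) :
    ∀ L ∈ DeltaTwoRel (oracle e),
      ∃ r : ℕ → ℕ, IsSublinear r ∧ L ∈ SIZERel (oracle e) (fun n => 2 * n + r n) := by
  intro L hL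
  obtain ⟨D, hM, hV, hD⟩ := exists_describes hL
  obtain ⟨d, hd⟩ := he (show D ∈ {D : Descr | _} from ⟨hM, hV⟩)
  have hD' : (e d).Describes (oracle e) L := by
    rw [hd]
    exact hD
  exact ⟨slack e d, isSublinear_slack e d, codeFamily e d,
    fun n => ⟨codeCircuit_isOver _ _ _ _, oracleSize_codeFamily_le e d n⟩, codeFamily_decides e d hD'⟩

end Wilson1985

/-! ### Hypothesis-free readings of Theorem 3.1 -/

/-- Hypothesis-free reading of Thm. 3.1: relative to some oracle `B`, every language of
`Δ₂^{P,B}` has `B`-oracle circuits of size `c·n + c` ("`Δ₂^{P,B}` has bounded linear size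
circuits relative to `B`"). [cite: Wilson1985, §1.2 (a) (p. 170) and Thm. 3.1 (p. 175)] -/
theorem exists_deltaTwo_subset_linear :
    ∃ B : Language Bool, DeltaTwoRel B ⊆ ⋃ c : ℕ, SIZERel B (fun n => c * n + c) :=
  Wilson1985_thm_3_1_holds.deltaTwo_subset_linear

/-- Hypothesis-free no-go reading of Thm. 3.1: **superlinear circuit lower bounds for `Δ₂^P` do
not relativize** — no oracle-indexed statement whose instance at every language oracle `A`
yields a language of `Δ₂^{P,A}` without linear-size `A`-oracle circuits holds relative to all
oracles ("we will not be able to obtain non-linear lower bounds for the circuit size of sets in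
P (or NP or `Δ₂^P` for that matter) with a proof technique which relativizes").
[cite: Wilson1985, §1.2 (a) (p. 170) and Thm. 3.1] -/
theorem not_relativizes_superlinear_deltaTwo {Φ : Oracle → Prop}
    (hΦ : ∀ A : Language Bool, Φ (Oracle.ofLanguage A) →
      ∃ L ∈ DeltaTwoRel A, ∀ c : ℕ, L ∉ SIZERel A (fun n => c * n + c)) :
    ¬ Relativizes Φ :=
  Wilson1985_thm_3_1_holds.not_relativizes_superlinear_deltaTwo hΦ

end Literature.Barriers.PneNP
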